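import Mathlib
import HarnessLib

/-!
# Crux `WeakCouplingHypercubicLimitRP` (stmt-QuantumFields-27398), line `Sketch`, door B (`sign-twisted-diagonal-trace`):
# the REAL-ANALYSIS core of the door-B proof, re-homed under `Theorems/` — summability bookkeeping, the diagonal (spectral)
# sign-twisted trace bound, the per-`k` pairing lower bound, the `liminf` lemma, and «the sector top state is even»

Helper file (`--supports stmt-QuantumFields-27398 --as helper`) of the hand `hand-10604-wilsonDiagModel-2` (docket director-ym g23, O4 WORD
18 (3)(ii) / 20: door-B suppliers along `φ`; this is the analysis that `core_of` runs at every sub-scheme) for the registered stub D1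
`stub_diagRPOfPlaneLimits` of `Cruxes/WeakCouplingHypercubicLimitRP/Lines/Sketch.lean` (sha16 `7bf38c709623ad77`); it closes nothing by itself.

WHAT.  §4 + §4b of the door-B core workfile `Cruxes/DiagonalMirrorRPR/Lines/sign_twisted_diagonal_trace_core.lean` (κ3 text of record, critic
idea-crit-9 g12 bytes `900935a36c50070a` = tree `2db7ee148edeb495` on these sections, which κ1–κ3 did not touch) BYTE-FOR-BYTE and in the SAME
namespace `…Cruxes.DiagonalMirrorRPR.SignTwistedDiagonalTrace`, so the line writer re-points the core by `import` + deleting §4/§4b (mechanism of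
κ1 p825205, κ2′ p827497): `summable_pow_of_sq`, `summable_pow_mul_of_sq`, `tsum_pow_eq_mul_tsum_div_pow`, `twistedTrace_diag` (series form of the
landed finite-dimensional `twistedTraceBound`, `…Theorems.DiagonalMirrorRPRTwistedTrace`, cited not imported), `pairing_lower_bound` (the per-`k`
core inequality: two-sector data, wrong-sign moduli `≤ g·λ₀`, lukewarm bounds, pairing identity, weight domination ⇒ `pairing ≥ −2 C B² g^{S−2d−2t}`),
`liminf_nonneg_of_eventually_ge`, `finite_top_set`, `tendsto_tsum_div_pow_ncard` (Tannery along the normalised power sums), `sectorTopStateEven`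
(the top multiplet has at least as many `U`-even as `U`-odd states).  Pure real analysis over `Mathlib`: no lattice object, no definition.

HONEST FRAMING: analysis lemmas only; nothing here bears on D1, ⟨27398⟩, S6i or the summit; the Yang–Mills mass gap is NOT proved here or anywhere in
the tree.  No instance, no notation, `autoImplicit false`.

References: Kanazawa arXiv:0808.3442 Lemma 2; Tomboulis–Yaffe, Comm. Math. Phys. 100 (1985) §2 (sign / multiplet structure of twisted transfer
matrices); Osterwalder–Seiler, Ann. Phys. 110 (1978) §2–3.
-/

set_option autoImplicit false

noncomputable section

open Filter Topology

namespace Summit.QuantumFields.YangMills.Cruxes.DiagonalMirrorRPR.SignTwistedDiagonalTrace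

/-! ## §4 Real-analysis core: summability bookkeeping, the diagonal twisted trace bound, the liminf lemma -/

section Analysis

/-- Powers `s^m`, `m ≥ 2`, of a square-summable sequence bounded by `lam` are summable. -/
theorem summable_pow_of_sq {s : ℕ → ℝ} {lam : ℝ} (h0 : ∀ j, 0 ≤ s j) (hle : ∀ j, s j ≤ lam)
    (hs : Summable fun j => s j ^ 2) {m : ℕ} (hm : 2 ≤ m) : Summable fun j => s j ^ m := by
  obtain ⟨i, rfl⟩ := Nat.exists_eq_add_of_le hm
  refine Summable.of_nonneg_of_le (fun j => pow_nonneg (h0 j) _) (fun j => ?_) (hs.mul_left (lam ^ i))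
  rw [pow_add, mul_comm]
  exact mul_le_mul_of_nonneg_right (pow_le_pow_left₀ (h0 j) (hle j) i) (pow_nonneg (h0 j) 2)

/-- Weighted powers `s^m w`, `m ≥ 2`, `0 ≤ w ≤ W`, are summable. -/
theorem summable_pow_mul_of_sq {s w : ℕ → ℝ} {lam W : ℝ} (h0 : ∀ j, 0 ≤ s j) (hle : ∀ j, s j ≤ lam)
    (hs : Summable fun j => s j ^ 2) (hw0 : ∀ j, 0 ≤ w j) (hwW : ∀ j, w j ≤ W) {m : ℕ} (hm : 2 ≤ m) :
    Summable fun j => s j ^ m * w j := by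
  refine Summable.of_nonneg_of_le (fun j => mul_nonneg (pow_nonneg (h0 j) _) (hw0 j)) (fun j => ?_)
    ((summable_pow_of_sq h0 hle hs hm).mul_right W)
  exact mul_le_mul_of_nonneg_left (hwW j) (pow_nonneg (h0 j) _)

/-- Normalised power sums: `Σ s^n = lam^n · Σ (s/lam)^n`. -/
theorem tsum_pow_eq_mul_tsum_div_pow (s : ℕ → ℝ) {lam : ℝ} (hlam : lam ≠ 0) (n : ℕ) :
    ∑' j, s j ^ n = lam ^ n * ∑' j, (s j / lam) ^ n := by
  rw [← tsum_mul_left]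
  congr 1
  funext j
  rw [div_pow, mul_div_cancel₀ _ (pow_ne_zero n hlam)]

/-- **Diagonal (spectral) form of the sign-twisted trace bound** — the series version of the landed
finite-dimensional `twistedTraceBound` (`Theorems/DiagonalMirrorRPRTwistedTrace.lean`): if the wrong-sign moduli are
`≤ μ` then `Σ sm^M wm ≤ μ^{M−2t} Σ sm^{2t} wm`, so `Σ sp^M wp − Σ sm^M wm ≥ −μ^{M−2t} (Σ sp^{2t} wp + Σ sm^{2t} wm)`. -/
theorem twistedTrace_diag {sp sm wp wm : ℕ → ℝ} {lam μ W : ℝ} {M t : ℕ} (hμ : 0 ≤ μ)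
    (hsp0 : ∀ j, 0 ≤ sp j) (hsm0 : ∀ j, 0 ≤ sm j) (hsml : ∀ j, sm j ≤ lam)
    (hsmμ : ∀ j, sm j ≤ μ) (hsum_m : Summable fun j => sm j ^ 2)
    (hwp0 : ∀ j, 0 ≤ wp j) (hwm0 : ∀ j, 0 ≤ wm j) (hW : ∀ j, wp j ≤ W ∧ wm j ≤ W) (ht : 1 ≤ t) (htM : 2 * t ≤ M) :
    -(μ ^ (M - 2 * t) * (∑' j, sp j ^ (2 * t) * wp j + ∑' j, sm j ^ (2 * t) * wm j)) ≤
      ∑' j, sp j ^ M * wp j - ∑' j, sm j ^ M * wm j := by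
  have h2t : 2 ≤ 2 * t := by omega
  have hM2 : 2 ≤ M := le_trans h2t htM
  have hP : 0 ≤ ∑' j, sp j ^ M * wp j := tsum_nonneg fun j => mul_nonneg (pow_nonneg (hsp0 j) _) (hwp0 j)
  have hPt : 0 ≤ ∑' j, sp j ^ (2 * t) * wp j := tsum_nonneg fun j => mul_nonneg (pow_nonneg (hsp0 j) _) (hwp0 j)
  have hterm : ∀ j, sm j ^ M * wm j ≤ μ ^ (M - 2 * t) * (sm j ^ (2 * t) * wm j) := by
    intro j
    obtain ⟨e, he⟩ := Nat.exists_eq_add_of_le htM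
    rw [he, Nat.add_sub_cancel_left, pow_add, mul_comm (sm j ^ (2 * t)), mul_assoc]
    exact mul_le_mul_of_nonneg_right (pow_le_pow_left₀ (hsm0 j) (hsmμ j) e)
      (mul_nonneg (pow_nonneg (hsm0 j) _) (hwm0 j))
  have hN : ∑' j, sm j ^ M * wm j ≤ μ ^ (M - 2 * t) * ∑' j, sm j ^ (2 * t) * wm j := by
    rw [← tsum_mul_left]
    exact Summable.tsum_le_tsum hterm
      (summable_pow_mul_of_sq hsm0 hsml hsum_m hwm0 (fun j => (hW j).2) hM2)
      ((summable_pow_mul_of_sq hsm0 hsml hsum_m hwm0 (fun j => (hW j).2) h2t).mul_left _)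
  have hμk : 0 ≤ μ ^ (M - 2 * t) := pow_nonneg hμ _
  nlinarith [mul_nonneg hμk hPt]

/-- **The per-`k` core inequality.**  Two-sector data with top modulus `lam` attained on the even sector, wrong-sign
moduli `≤ g·lam`, lukewarm bounds at `t` and `t+d`, the pairing identity and weight domination give
`pairing ≥ −2 C B² g^{S−2d−2t}`. -/
theorem pairing_lower_bound {sp sm wp wm : ℕ → ℝ} {lam g C B p W : ℝ} {S d t : ℕ}
    (hlam : 0 < lam) (hsp0 : ∀ j, 0 ≤ sp j) (hsm0 : ∀ j, 0 ≤ sm j) (hspl : ∀ j, sp j ≤ lam)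
    (hsml : ∀ j, sm j ≤ lam) (hsmg : ∀ j, sm j ≤ g * lam) (hg0 : 0 ≤ g)
    (hsum_p : Summable fun j => sp j ^ 2) (hsum_m : Summable fun j => sm j ^ 2)
    (hwp0 : ∀ j, 0 ≤ wp j) (hwm0 : ∀ j, 0 ≤ wm j) (hW : ∀ j, wp j ≤ W ∧ wm j ≤ W)
    (htop : ∃ j, sp j = lam) (ht1 : 1 ≤ t) (htd : 2 * t + 2 * d ≤ S)
    (hluke_t : ∑' j, (sp j / lam) ^ (2 * t) + ∑' j, (sm j / lam) ^ (2 * t) ≤ C)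
    (hluke_td : ∑' j, (sp j / lam) ^ (2 * t + 2 * d) + ∑' j, (sm j / lam) ^ (2 * t + 2 * d) ≤ C)
    (hhalf : C * g ^ (S - 2 * t) ≤ 1 / 2)
    (hpair : p * (∑' j, sp j ^ S - ∑' j, sm j ^ S) =
      ∑' j, sp j ^ (S - 2 * d) * wp j - ∑' j, sm j ^ (S - 2 * d) * wm j)
    (hdom : ∑' j, sp j ^ (2 * t) * wp j + ∑' j, sm j ^ (2 * t) * wm j ≤
      B ^ 2 * (∑' j, sp j ^ (2 * t + 2 * d) + ∑' j, sm j ^ (2 * t + 2 * d))) :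
    -(2 * C * B ^ 2 * g ^ (S - 2 * d - 2 * t)) ≤ p := by
  have hlam0 : lam ≠ 0 := hlam.ne'
  have hglam : 0 ≤ g * lam := mul_nonneg hg0 hlam.le
  have hS2 : 2 ≤ S := by omega
  have h2t : 2 ≤ 2 * t := by omega
  have hM2 : 2 ≤ S - 2 * d := by omega
  have htM : 2 * t ≤ S - 2 * d := by omega
  -- nonnegativity of the normalised sums, hence of `C`
  have hnp : ∀ n, 0 ≤ ∑' j, (sp j / lam) ^ n := fun n => tsum_nonneg fun j => pow_nonneg (div_nonneg (hsp0 j) hlam.le) _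
  have hnm : ∀ n, 0 ≤ ∑' j, (sm j / lam) ^ n := fun n => tsum_nonneg fun j => pow_nonneg (div_nonneg (hsm0 j) hlam.le) _
  have hC0 : 0 ≤ C := le_trans (add_nonneg (hnp _) (hnm _)) hluke_t
  -- (1) the wrong-sign part of the numerator
  have htw := twistedTrace_diag (M := S - 2 * d) hglam hsp0 hsm0 hsml hsmg hsum_m hwp0 hwm0 hW ht1 htM
  have hX : (g * lam) ^ (S - 2 * d - 2 * t) * (∑' j, sp j ^ (2 * t) * wp j + ∑' j, sm j ^ (2 * t) * wm j) ≤
      g ^ (S - 2 * d - 2 * t) * lam ^ S * B ^ 2 * C := by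
    have hsum_eq : ∑' j, sp j ^ (2 * t + 2 * d) + ∑' j, sm j ^ (2 * t + 2 * d) =
        lam ^ (2 * t + 2 * d) * (∑' j, (sp j / lam) ^ (2 * t + 2 * d) + ∑' j, (sm j / lam) ^ (2 * t + 2 * d)) := by
      rw [tsum_pow_eq_mul_tsum_div_pow sp hlam0, tsum_pow_eq_mul_tsum_div_pow sm hlam0, mul_add]
    have h1 : ∑' j, sp j ^ (2 * t) * wp j + ∑' j, sm j ^ (2 * t) * wm j ≤ B ^ 2 * (lam ^ (2 * t + 2 * d) * C) := by
      refine hdom.trans ?_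
      rw [hsum_eq]
      exact mul_le_mul_of_nonneg_left (mul_le_mul_of_nonneg_left hluke_td (pow_nonneg hlam.le _)) (sq_nonneg B)
    have hexp : (g * lam) ^ (S - 2 * d - 2 * t) * (B ^ 2 * (lam ^ (2 * t + 2 * d) * C)) =
        g ^ (S - 2 * d - 2 * t) * lam ^ S * B ^ 2 * C := by
      have hlamS : lam ^ S = lam ^ (S - 2 * d - 2 * t) * lam ^ (2 * t + 2 * d) := by
        rw [← pow_add]; congr 1; omega
      rw [hlamS, mul_pow]
      ring
    rw [← hexp]
    exact mul_le_mul_of_nonneg_left h1 (pow_nonneg hglam _)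
  -- so the numerator is `≥ −X`
  have hnum : -(g ^ (S - 2 * d - 2 * t) * lam ^ S * B ^ 2 * C) ≤
      ∑' j, sp j ^ (S - 2 * d) * wp j - ∑' j, sm j ^ (S - 2 * d) * wm j := by
    have : (S - 2 * d) - 2 * t = S - 2 * d - 2 * t := rfl
    linarith [htw, hX]
  -- (2) the denominator `Z ≥ lam^S / 2`
  have hZp : lam ^ S ≤ ∑' j, sp j ^ S := by
    obtain ⟨j₀, hj₀⟩ := htop
    rw [← hj₀]
    exact (summable_pow_of_sq hsp0 hspl hsum_p hS2).le_tsum j₀ fun j _ => pow_nonneg (hsp0 j) _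
  have hZm : ∑' j, sm j ^ S ≤ g ^ (S - 2 * t) * lam ^ S * C := by
    have hterm : ∀ j, sm j ^ S ≤ (g * lam) ^ (S - 2 * t) * sm j ^ (2 * t) := by
      intro j
      have hS : S = (S - 2 * t) + 2 * t := by omega
      conv_lhs => rw [hS, pow_add]
      exact mul_le_mul_of_nonneg_right (pow_le_pow_left₀ (hsm0 j) (hsmg j) _) (pow_nonneg (hsm0 j) _)
    have h1 : ∑' j, sm j ^ S ≤ (g * lam) ^ (S - 2 * t) * ∑' j, sm j ^ (2 * t) := by
      rw [← tsum_mul_left]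
      exact Summable.tsum_le_tsum hterm (summable_pow_of_sq hsm0 hsml hsum_m hS2)
        ((summable_pow_of_sq hsm0 hsml hsum_m h2t).mul_left _)
    have h2 : ∑' j, sm j ^ (2 * t) ≤ lam ^ (2 * t) * C := by
      rw [tsum_pow_eq_mul_tsum_div_pow sm hlam0]
      exact mul_le_mul_of_nonneg_left (le_trans (le_add_of_nonneg_left (hnp _)) hluke_t) (pow_nonneg hlam.le _)
    have hexp : (g * lam) ^ (S - 2 * t) * (lam ^ (2 * t) * C) = g ^ (S - 2 * t) * lam ^ S * C := by
      have hlamS : lam ^ S = lam ^ (S - 2 * t) * lam ^ (2 * t) := by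
        rw [← pow_add]; congr 1; omega
      rw [hlamS, mul_pow]
      ring
    calc ∑' j, sm j ^ S ≤ (g * lam) ^ (S - 2 * t) * ∑' j, sm j ^ (2 * t) := h1
      _ ≤ (g * lam) ^ (S - 2 * t) * (lam ^ (2 * t) * C) := mul_le_mul_of_nonneg_left h2 (pow_nonneg hglam _)
      _ = g ^ (S - 2 * t) * lam ^ S * C := hexp
  have hlamS : 0 < lam ^ S := pow_pos hlam S
  have hZ : lam ^ S / 2 ≤ ∑' j, sp j ^ S - ∑' j, sm j ^ S := by
    have : g ^ (S - 2 * t) * lam ^ S * C ≤ lam ^ S / 2 := by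
      have := mul_le_mul_of_nonneg_left hhalf hlamS.le
      linarith [this]
    linarith
  -- (3) conclude
  by_contra hcon
  push Not at hcon
  have hKnonneg : 0 ≤ 2 * C * B ^ 2 * g ^ (S - 2 * d - 2 * t) := by positivity
  have hp0 : p < 0 := by linarith
  have h1 : p * (∑' j, sp j ^ S - ∑' j, sm j ^ S) ≤ p * (lam ^ S / 2) := mul_le_mul_of_nonpos_left hZ hp0.le
  have h2 : p * (lam ^ S / 2) < -(2 * C * B ^ 2 * g ^ (S - 2 * d - 2 * t)) * (lam ^ S / 2) :=
    mul_lt_mul_of_pos_right hcon (by positivity)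
  have h3 : -(2 * C * B ^ 2 * g ^ (S - 2 * d - 2 * t)) * (lam ^ S / 2) =
      -(g ^ (S - 2 * d - 2 * t) * lam ^ S * B ^ 2 * C) := by ring
  linarith [hpair, hnum]

/-- `liminf ≥ 0` from eventual lower bounds `−ε_k` with `ε_k → 0` (covers the unbounded case through the junk value
of `sSup` on `ℝ`). -/
theorem liminf_nonneg_of_eventually_ge {u ε : ℕ → ℝ} (hε : Tendsto ε atTop (𝓝 0))
    (h : ∀ᶠ k in atTop, -ε k ≤ u k) : 0 ≤ Filter.liminf u atTop := by
  have key : ∀ δ : ℝ, 0 < δ → ∀ᶠ k in atTop, -δ ≤ u k := by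
    intro δ hδ
    filter_upwards [h, Metric.tendsto_nhds.1 hε δ hδ] with k hk hk'
    rw [Real.dist_0_eq_abs] at hk'
    linarith [neg_abs_le (ε k), le_abs_self (ε k)]
  by_cases hco : IsCoboundedUnder (· ≥ ·) atTop u
  · refine le_of_forall_pos_le_add fun δ hδ => ?_
    have := le_liminf_of_le hco (key δ hδ)
    linarith
  · rw [Filter.liminf_eq, Real.sSup_of_not_bddAbove]
    intro hb
    apply hco
    obtain ⟨b, hb⟩ := hb
    exact ⟨b, fun a ha => hb (by simpa [Filter.eventually_map] using ha)⟩

/-- The top multiplet of a square-summable sequence is finite. -/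
theorem finite_top_set {s : ℕ → ℝ} {lam : ℝ} (hlam : 0 < lam) (hs : Summable fun j => s j ^ 2) :
    {j | s j = lam}.Finite := by
  have h2 : ∀ᶠ j in cofinite, s j ^ 2 < lam ^ 2 :=
    hs.tendsto_cofinite_zero.eventually (gt_mem_nhds (by positivity))
  refine (Filter.eventually_cofinite.1 h2).subset fun j hj => ?_
  simp only [Set.mem_setOf_eq] at hj ⊢
  rw [hj]
  exact lt_irrefl _

end Analysis

/-! ## §4b The sector top state is even (multiplet form) — the docket's stub S1, DISCHARGED here -/

/-- The normalised power sums of a square-summable family in `[0, lam]` tend to the multiplicity of `lam`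
(Tannery / dominated convergence for series). -/
theorem tendsto_tsum_div_pow_ncard {s : ℕ → ℝ} {lam : ℝ} (hlam : 0 < lam) (h0 : ∀ j, 0 ≤ s j)
    (hle : ∀ j, s j ≤ lam) (hs : Summable fun j => s j ^ 2) :
    Tendsto (fun m : ℕ => ∑' j, (s j / lam) ^ m) atTop (𝓝 ({j | s j = lam}.ncard : ℝ)) := by
  have hfin := finite_top_set hlam hs
  set g : ℕ → ℝ := fun j => if s j = lam then 1 else 0 with hg_def
  have hg_tsum : ∑' j, g j = ({j | s j = lam}.ncard : ℝ) := by
    have hzero : ∀ j ∉ hfin.toFinset, g j = 0 := by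
      intro j hj
      simp only [Set.Finite.mem_toFinset, Set.mem_setOf_eq] at hj
      simp [hg_def, hj]
    have hone : ∀ j ∈ hfin.toFinset, g j = 1 := by
      intro j hj
      simp only [Set.Finite.mem_toFinset, Set.mem_setOf_eq] at hj
      simp [hg_def, hj]
    rw [tsum_eq_sum hzero, Finset.sum_congr rfl hone, Finset.sum_const, nsmul_eq_mul, mul_one,
      Set.ncard_eq_toFinset_card _ hfin]
  rw [← hg_tsum]
  refine tendsto_tsum_of_dominated_convergence (bound := fun j => (s j / lam) ^ 2) ?_ ?_ ?_
  · simpa [div_pow] using hs.div_const (lam ^ 2)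
  · intro j
    by_cases hj : s j = lam
    · simp [hg_def, hj, hlam.ne']
    · have hlt : s j / lam < 1 := (div_lt_one hlam).2 (lt_of_le_of_ne (hle j) hj)
      simpa [hg_def, hj] using tendsto_pow_atTop_nhds_zero_of_lt_one (div_nonneg (h0 j) hlam.le) hlt
  · filter_upwards [Filter.eventually_ge_atTop 2] with m hm j
    rw [Real.norm_eq_abs, abs_pow, abs_of_nonneg (div_nonneg (h0 j) hlam.le)]
    exact pow_le_pow_of_le_one (div_nonneg (h0 j) hlam.le) ((div_le_one hlam).2 (hle j)) hm

/-- **sectorTopStateEven** (MULTIPLET form of annex A3/A7 — `Tr (E U) ≥ 0` on the top eigenspace `E` of `|A|`: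
the top multiplet has at least as many `U`-even as `U`-odd states; the docket's stub S1, PROVED).  For two
square-summable families of moduli in `[0, lam]` whose odd traces are eventually ordered (`Σ sm^m ≤ Σ sp^m` for all
large odd `m` — kernel positivity of the twisted tori, `DiagonalSliceModel.trace_nonneg`), the multiplicity of `lam`
among the `sm` is at most its multiplicity among the `sp`.  Proof: divide by `lam^m` and let `m → ∞` along odd `m`
(`tendsto_tsum_div_pow_ncard`); cf. the strict-top version `WrongSignAnnex.topSign_of_odd_traces`
(`SketchSeat2Annex.lean`), Kanazawa arXiv:0808.3442 Lemma 2, Tomboulis–Yaffe CMP 100 (1985) §2. -/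
theorem sectorTopStateEven (sp sm : ℕ → ℝ) (lam : ℝ) (hlam : 0 < lam)
    (hsp : ∀ j, 0 ≤ sp j ∧ sp j ≤ lam) (hsm : ∀ j, 0 ≤ sm j ∧ sm j ≤ lam)
    (hsum_p : Summable fun j => sp j ^ 2) (hsum_m : Summable fun j => sm j ^ 2)
    (htr : ∀ᶠ m in atTop, Odd m → ∑' j, sm j ^ m ≤ ∑' j, sp j ^ m) :
    {j | sm j = lam}.ncard ≤ {j | sp j = lam}.ncard := by
  have hp := tendsto_tsum_div_pow_ncard hlam (fun j => (hsp j).1) (fun j => (hsp j).2) hsum_p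
  have hm := tendsto_tsum_div_pow_ncard hlam (fun j => (hsm j).1) (fun j => (hsm j).2) hsum_m
  -- along odd exponents `m = 2 i + 1`
  have hodd : Tendsto (fun i : ℕ => 2 * i + 1) atTop atTop :=
    tendsto_atTop_mono (fun i => show i ≤ 2 * i + 1 by omega) tendsto_id
  have hev : ∀ᶠ i : ℕ in atTop, ∑' j, (sm j / lam) ^ (2 * i + 1) ≤ ∑' j, (sp j / lam) ^ (2 * i + 1) := by
    filter_upwards [hodd.eventually htr] with i hi
    have h := hi ⟨i, rfl⟩
    rw [tsum_pow_eq_mul_tsum_div_pow sm hlam.ne', tsum_pow_eq_mul_tsum_div_pow sp hlam.ne'] at h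
    exact le_of_mul_le_mul_left h (pow_pos hlam _)
  have hle : ({j | sm j = lam}.ncard : ℝ) ≤ ({j | sp j = lam}.ncard : ℝ) :=
    le_of_tendsto_of_tendsto (hm.comp hodd) (hp.comp hodd) hev
  exact_mod_cast hle


end Summit.QuantumFields.YangMills.Cruxes.DiagonalMirrorRPR.SignTwistedDiagonalTrace

end
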